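import Summits.BirchSwinnertonDyer.BirchSwinnertonDyer.Theorems.KolyvaginDepthDoorDepthTableRowKitNoTwistOfDatum
import Summits.BirchSwinnertonDyer.BirchSwinnertonDyer.Theorems.KolyvaginDepthDoorKolyvaginDepthSupplyDoorOfDatumDepth
import HarnessLib

/-!
# Route `KolyvaginDepthDoor` — the TWIST-SELMER ROW KIT OF A DATUM: `#Sel^(p)(E^{(D)}/ℚ) ≤ p` from ONE
# datum's bit, no structure theorem, no twist point, NO SYSTEM (crux `KolyvaginDepthSupply`,
# stmt-BirchSwinnertonDyer-21765)

Helper file (`--supports stmt-BirchSwinnertonDyer-21765 --as helper`); it closes nothing and BSD is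
not proved by it.

g6's kit `depthRow_noTwist_twistSelmer_of_print_of_intModel_certificate` (file
`…DepthTableRowKitNoTwistTwistSelmer`) read the twist's `p`-Selmer order off a depth-table row modulo a
COMPATIBLE SYSTEM of Kolyvagin–Heegner data (not known to be inhabited at level `0`). This file drops the
system (`natCard_selmerGroup_twist_le_of_kolyvaginClass_ne_zero_of_datum`, file `…DoorOfDatumDepth`; the
compatible system through the datum is the UNCONDITIONAL theorem `exists_kolyvaginHeegnerSystem_extending`):

* `depthRow_noTwist_twistSelmer_of_datum_of_intModel_certificate` — inputs: the integer-model certificate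
  of the row, the five named McCallum/Gross facts, ONE datum `d : KolyvaginHeegnerData Dt β ι ℓ` and its
  bit `d.kolyvaginClass hp 1 ≠ 0`; OUTPUT: `#Sel^(p)(E^{(D)}/ℚ) ≤ p` and
  `p^{rank_ℤ E^{(D)}(ℚ)} · #E^{(D)}(ℚ)[p] · #Ш(E^{(D)}/ℚ)[p] ≤ p`.

CONDITIONAL on the five named facts and the bit; per-curve; BSD is not proved by it.

References: [Kolyvagin1991MathAnn] Thm. 2.3; [GrossLMS1991] §§3–5, §10; [McCallumLMS1991] §§2–5;
[WZhang2014] Notations (xii).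
-/

set_option linter.dupNamespace false

noncomputable section

open scoped Classical NumberField

namespace Summit.BirchSwinnertonDyer.BirchSwinnertonDyer.Theorems.KolyvaginDepthDoor

open Literature.NumberTheory.EllipticCurves Literature.NumberTheory.EllipticCurves.ModularForms
  Literature.NumberTheory.EllipticCurves.McCallum1991 WeierstrassCurve NumberField IsDedekindDomain

section Generic

variable {W : WeierstrassCurve ℚ} [W.IsElliptic] [W.IsGloballyMinimal] {E₀ : WeierstrassCurve ℤ}
  (hI : integralModelInt W = E₀)
include hI

/-- **The order of `Sel_p(E^{(D)}/ℚ)` from a depth-table row, off an integer model — OF A DATUM** (no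
`hF`, no twist point, no system). Inputs VERBATIM those of `depthRow_noTwist_of_datum_of_intModel_certificate`;
OUTPUT from the bit `d.kolyvaginClass hp 1 ≠ 0`: `#Sel^(p)(E^{(D)}/ℚ) ≤ p` and
`p^{rank_ℤ E^{(D)}(ℚ)} · #E^{(D)}(ℚ)[p] · #Ш(E^{(D)}/ℚ)[p] ≤ p`
(`natCard_selmerGroup_twist_le_of_kolyvaginClass_ne_zero_of_datum` at `n₁ = ℓ`, with the row kit's
`isKolyvaginPrime_of_intModel_certificate` and `satisfiesHeegnerHypothesis_conductorNorm_of_intModel`).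
CONDITIONAL on the five facts; per-curve; BSD is not proved by it. [cite: Kolyvagin1991MathAnn, Thm. 2.3]
[cite: McCallumLMS1991, §§2–5] [cite: GrossLMS1991, §5 (5.1)] [cite: WZhang2014, Notations (xii)] -/
theorem depthRow_noTwist_twistSelmer_of_datum_of_intModel_certificate
    (h54 : sign_conjAct_kolyvaginClass) (h43 : lemma43_kolyvaginClass_mem_selmerLocalKer)
    (h44 : prop44_localOrder_kolyvaginClass_mul_eq) (h53 : lemma53_selmer_eigen_dependent_at)
    (h22 : prop22_reciprocity_eigen_finset)
    (hcm : ¬ W.HasCM) (hr : 2 ≤ W.mordellWeilRank)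
    (p : ℕ) [hp : Fact p.Prime] (hp2 : p ≠ 2)
    (htower : ∀ n : ℕ, W.HasSurjectiveModNGaloisRep (p ^ n : ℕ))
    (K : Type) [Field K] [NumberField K] (hK : IsImaginaryQuadratic K) {D : ℤ}
    (hD : NumberField.discr K = D) (h3 : D ≠ -3) (h4 : D ≠ -4)
    (hH : ∀ q : ℕ, q.Prime → (q : ℤ) ∣ E₀.Δ → (q = 2 → D % 8 = 1) ∧ (q ≠ 2 → jacobiSym D q = 1))
    (ℓ : ℕ) (hℓ : ℓ.Prime) (hℓ2 : ℓ ≠ 2) (hℓΔ : ¬ (ℓ : ℤ) ∣ E₀.Δ) (hℓD : ¬ (ℓ : ℤ) ∣ D)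
    (hℓp : ℓ ≠ p) (hjac : jacobiSym D ℓ = -1) (hℓ1 : p ∣ ℓ + 1) {n : ℕ}
    (hcard : Nat.card ((E₀.map (Int.castRingHom (ZMod ℓ))).toAffine.Point) = n)
    (haℓ : (p : ℤ) ∣ (ℓ : ℤ) + 1 - n)
    [NeZero (W.conductorNorm ℤ)] (Dt : ModularParametrizationData W (W.conductorNorm ℤ)) (β : ℤ)
    (ι : K →+* ℂ) (d : KolyvaginHeegnerData Dt β ι ℓ) (hne : d.kolyvaginClass hp.out 1 ≠ 0) :
    Nat.card ↥(selmerGroup (W.quadraticTwist (D : ℚ)) (p : ℤ)) ≤ p ∧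
      p ^ (W.quadraticTwist (D : ℚ)).mordellWeilRank *
          Nat.card ↥(AddSubgroup.torsionBy (W.quadraticTwist (D : ℚ)).toAffine.Point (p : ℤ)) *
          Nat.card ↥((W.quadraticTwist (D : ℚ)).sha ⊓
            AddSubgroup.torsionBy (W.quadraticTwist (D : ℚ)).galH1 (p : ℤ)) ≤ p := by
  obtain ⟨hkol, -⟩ := isKolyvaginPrime_of_intModel_certificate hI p K hK.1 hD ℓ hℓ hℓ2 hℓΔ hℓD
    hℓp hjac hℓ1 hcard haℓ
  obtain ⟨c, hc, hcc⟩ := exists_conj_of_isImaginaryQuadratic K hK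
  have hH' := satisfiesHeegnerHypothesis_conductorNorm_of_intModel hI K hK.1 hD hH
  have hcard1 : ℓ.primeFactors.card = 1 := by rw [hℓ.primeFactors, Finset.card_singleton]
  obtain ⟨-, hSel, hcount⟩ :=
    natCard_selmerGroup_twist_le_of_kolyvaginClass_ne_zero_of_datum h54 h43 h44 h53 h22 hcm hK
      (by rw [hD]; exact h3) (by rw [hD]; exact h4) hH' p hp2 htower c hc hcc hℓ.prime.squarefree
      (fun q hq ↦ by
        rw [hℓ.primeFactors, Finset.mem_singleton] at hq
        exact hq ▸ hkol) d hne (by rw [hcard1]; exact hr)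
  rw [hcard1, pow_one] at hSel hcount
  rw [hD] at hSel hcount
  exact ⟨hSel, hcount⟩

end Generic

end Summit.BirchSwinnertonDyer.BirchSwinnertonDyer.Theorems.KolyvaginDepthDoor

end
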